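import Mathlib.LinearAlgebra.Matrix.PosDef
import Mathlib.Algebra.Order.Star.Real
import Mathlib.LinearAlgebra.Matrix.Trace
import Mathlib.LinearAlgebra.Matrix.Determinant.Basic
import Mathlib.Analysis.SpecialFunctions.Log.Basic
import Mathlib.Analysis.SpecialFunctions.Trigonometric.DerivHyp
import Mathlib.Analysis.SpecialFunctions.Sqrt
import Mathlib.Probability.Distributions.Gaussian.Real
import HarnessLib

/-!
# Lossy squeezed states: the `V = V_p + W` decomposition, the squeezed-thermal form, (t)-classicality

Topic `Literature/Computability/QuantumComplexity` (pub-qadeq lane; the single-mode covariance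
vocabulary behind the classical-simulability statements quoted in the status cells of the Gaussian
boson sampling rows, CLAIMS E-11…E-15 / S-4, S-4b).

HONEST FRAMING: instance-level adjudication of specific advantage claims; no claim about BQP vs BPP
or the summit. Nothing here identifies a `2 × 2` real matrix with a density operator, says anything
about which experiment has which transmission, or asserts any running time; the file records, as
printed and with proofs, the covariance-matrix ARITHMETIC that the two sources below build their
algorithms and thresholds on (`ħ = 2` convention: the vacuum covariance matrix is the identity).

## Sources (verbatim)

[OhEtAl2024] C. Oh, M. Liu, Y. Alexeev, B. Fefferman, L. Jiang, *Classical algorithm for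
simulating experimental Gaussian boson sampling*, Nature Physics 20, 1461–1468 (2024)
= arXiv:2306.03709 (held text `paper:arxiv-2306.03709`).
* §III.A, p. 2–3: "we decompose the output Gaussian state's covariance matrix into two parts as
  `V = V_p + W`, where `V_p` represents the covariance matrix of a pure Gaussian state and `W ⪰ 0`";
  "if we approximate the quantum part `V_p` as a vacuum state `1_{2M}`, then the corresponding
  simulation becomes a thermal-state approximation with covariance matrix `W + 1_{2M}`."
* eq. (4)–(5), p. 4 and Appendix B (heading p. 14; (B1)–(B3) p. 15): "`V_0 = diag(e^{2r}, e^{−2r})` (B1) …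
  `V = ηV_0 + (1 − η)1_2 = diag(ηe^{2r} + 1 − η, ηe^{−2r} + 1 − η)` (B2). By setting
  `ηe^{−2r} + (1 − η) = e^{−2s}`, we can decompose the covariance matrix `V` as
  `V = diag(e^{2s}, e^{−2s}) + diag(ηe^{2r} + 1 − η − e^{2s}, 0) ≡ V_p + W` (B3), where `W`'s
  first matrix element is nonnegative when `r ≥ 0`. Here we call `s` an actual squeezing
  parameter"; p. 4: "even if the input squeezing is infinite, that is, `r → ∞`, the actual
  squeezing is only `s = −1/2 log(1 − η)`"; "the proposed decomposition separates the output
  photons into two contributions: the quantum resource from `V_p` and the classical resource from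
  the random displacement `W`".
* Appendix B (B4)–(B8), p. 15 (Williamson decomposition of Ref. [30]):
  "`V = diag(e^t, e^{−t}) diag(2n_th + 1, 2n_th + 1) diag(e^t, e^{−t})` (B4) `= diag(e^{2t}, e^{−2t})
  + 2 diag(n_th e^{2t}, n_th e^{−2t})` (B6). Here `t = ¼ log((ηe^{2r} + 1 − η)/(ηe^{−2r} + 1 − η))`
  (B7) and `n_th = ½(√((ηe^{2r} + 1 − η)(ηe^{−2r} + 1 − η)) − 1)` (B8). One can easily show that
  `t > s`, namely, our minimization, gives a smaller photon number for the quantum part."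
* §VII.A, p. 13: "For a given covariance matrix, we can obtain the average photon number by
  `Tr[V − 1_{2M}]/4` if the first-moment vector of the state is zero."

[QiEtAl2020] H. Qi, D. J. Brod, N. Quesada, R. García-Patrón, *Regimes of classical simulability for
noisy Gaussian boson sampling*, Phys. Rev. Lett. 124, 100502 (2020) = arXiv:1905.12075 (held text
`paper:arxiv-1905.12075`).
* p. 2–3: "They satisfy the commutation relations (`ħ = 2`) … A Gaussian state is called classical
  if its P function (i.e., for `t = 1`) is well-behaved. We slightly generalize this notion of
  classicality and say that `ρ` is (t)-classical if `V_ρ − tI_2` is positive definite";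
  p. 2: "η∞ := q_D(1 + coth r), and `η < η∞` is the corresponding condition that follows for exact
  sampling (`ε = 0`) obtained previously in Ref. [11]"; "for exact sampling (`ε = 0`), inequality
  (1) gives trivial result `η < 0` … a squeezed state, under the effect of pure loss, never becomes
  exactly a classical state (though it approximates one arbitrarily well)"; p. 3: "this task can be
  simulated exactly with polynomial running time if `τ` is a (t)-classical state, for
  `t ∈ [1 − 2q_D, 1]`".
* eq. (3), p. 2: "The (t)-ordered phase-space quasi-probability distribution [(t)-PQD] of a single mode Gaussian
  state is given by `W^{(t)}_ρ(x) = exp[−½ xᵀ(V_ρ − tI_2)⁻¹x] / (2π √det(V_ρ − tI_2))` (3). For `t = −1, 0` and `1`, we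
  obtain the Husimi, Wigner and Glauber-Sudarshan functions, respectively. Equation (56) [sic: (3)] only holds
  when `V_ρ − tI_2` is positive definite … for `t < t*_ρ` the (t)-PQD is a Gaussian function".
* Supplemental Material §III, eq. (20)–(23), p. 8–9: "`V_STS(s_ρ, n_ρ, φ_ρ) = (2n_ρ + 1)(…)` (20)
  … a single-mode Gaussian state is (t)-classical when `V_ρ − tI_2` is positive definite. From
  Eq. (20) we know that this happens when `s_ρ ≤ ½ ln((2n_ρ + 1)/t)` (21). For a lossy squeezed
  state `σ` with `V_σ = diag{a₊, a₋}` where `a± = ηe^{±2r} + (1 − η)`, … `s_σ = ¼ ln(a₊/a₋)` (22),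
  `n_σ = ½(√(a₊a₋) − 1)` (23)."

## Contents (all proved; 0 named facts; standard axioms)

* Vocabulary: `sqzCov r` (B1), `lossCov η V` (B2)/(4), `aPlus`/`aMinus` (the `a±` of (22)–(23)),
  `meanPhoton V = (Tr V − 2)/4`, `IsTClassical t V := (V − t•1).PosDef`.
* The decomposition (5)/(B3): `actualSqueezing η r = −½ log a₋`, `displacementNoise η r = W`,
  **`lossCov_sqzCov_eq_sqzCov_add_displacementNoise`** (`V = V_p + W`),
  `displacementNoise_apply_zero_nonneg` / **`posSemidef_displacementNoise`** (`W ⪰ 0`, via the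
  identity `aPlus_mul_aMinus : a₊a₋ = 1 + η(1 − η)(e^r − e^{−r})²`), `actualSqueezing_nonneg`,
  `actualSqueezing_le` (`s ≤ r`), `actualSqueezing_le_limit` (`s ≤ −½ log(1 − η)`),
  **`tendsto_actualSqueezing_atTop`** (`s → −½ log(1 − η)` as `r → ∞`), `actualSqueezing_mono`.
* Photon bookkeeping (§VII.A with (B3)): `meanPhoton_sqzCov = sinh² r`,
  `meanPhoton_lossCov_sqzCov = η sinh² r`, **`meanPhoton_lossCov_sqzCov_eq_add`**
  (output photons = `sinh² s` + `W₀₀/4`), `sinh_sq_actualSqueezing_le`.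
* Squeezed-thermal (Williamson) form (B4)–(B8) = SM (20)|_{diag}, (22), (23): `stsCov s n`,
  `williamsonSqueezing η r = t`, `thermalPhotons η r = n_th`, **`lossCov_sqzCov_eq_stsCov`**,
  `thermalPhotons_nonneg`, `det_lossCov_sqzCov` (`= a₊a₋ = (2n_th + 1)²`),
  `williamsonSqueezing_sub_actualSqueezing` (`t − s = ¼ log(a₊a₋)`),
  **`actualSqueezing_lt_williamsonSqueezing`** (`t > s` for `0 < η < 1`, `r ≠ 0`).
* (t)-classicality: `isTClassical_diagonal_iff`, **`isTClassical_stsCov_iff`** /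
  `isTClassical_stsCov_iff_lt_log` ((21): `s < ½ log((2n + 1)/t)`),
  `isTClassical_lossCov_sqzCov_iff` (`t < a₋`), **`not_isTClassical_one_lossCov_sqzCov`** (never
  classical under pure loss) with `isTClassical_lossCov_sqzCov_iff_lt` (but (t)-classical for every
  `t < 1` once `η(1 − e^{−2r}) < 1 − t`), **`isTClassical_lossCov_sqzCov_iff_lt_etaInfinity`**
  (`η∞ = q(1 + coth r)` is exactly the `(1 − 2q)`-classicality threshold),
  `isTClassical_displacementNoise_add_one` (the thermal-state approximation `W + 1` is
  (t)-classical for all `t < 1`).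
* Appendix (second part): `lossCov_lossCov` (losses compose: `η = η_S η_I`, [QiEtAl2020] p. 3),
  `lossCov_conj_of_mul_transpose_eq_one` (uniform loss commutes with passive orthogonal maps),
  `isTClassical_conj_iff`, **`sinh_sq_actualSqueezing_le_limit`** (`sinh² s ≤ η²/(4(1 − η))`, the
  `r → ∞` photon ceiling of [OhEtAl2024] Fig. 2(d), via `sinh_sq_limit`),
  `isTClassical_lossCov_sqzCov_iff_quantumPart` (`V` is (t)-classical iff `V_p` is).
* Appendix (third part): `tPQD t a b` = eq. (3) of [QiEtAl2020] written out for `V = diag(a, b)`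
  (`diagonal_sub_smul_one`, `det_diagonal_sub_smul_one`, `inv_diagonal_sub_smul_one` justify the coordinates),
  **`tPQD_eq_mul_gaussianPDFReal`** (for `t < a`, `t < b` it is the product of two centred normal densities of
  variances `a − t`, `b − t`), `tPQD_pos`, **`integral_tPQD_eq_one`** (it integrates to `1` over `ℝ²`: a genuine
  probability density exactly in the (t)-classical case of `isTClassical_diagonal_iff`).
* Appendix (fourth part): SM eq. (20) with a squeezing PHASE — `rot θ` (phase-space rotation, `rot θ (rot θ)ᵀ = 1`),
  `stsCovRot s n θ := rot θ · V_STS(s, n) · (rot θ)ᵀ`, its entries `stsCovRot_apply_*` =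
  `(2n + 1)(cosh 2s ± cos 2θ sinh 2s)`, `(2n + 1) sin 2θ sinh 2s` (eq. (20) is the case `2θ = φ + π`),
  **`isTClassical_stsCovRot_iff`** (the phase drops out: (t)-classical iff `V_STS(s, n)` is) and
  `isTClassical_stsCovRot_iff_lt_log` (criterion (21) for an arbitrary zero-mean single-mode Gaussian state).

Not covered: the correspondence between covariance matrices and Gaussian density operators, the
uncertainty relation `V ⪰ iΩ` in its complex form (for the diagonal matrices here it reads
`det V ≥ 1`, recorded as `one_le_det_lossCov_sqzCov`), multimode states and the SDP (3) of
[OhEtAl2024] (the general squeezing phase `φ` of SM (20) IS covered, single mode, by the fourth part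
of the appendix above: `stsCovRot`, `isTClassical_stsCovRot_iff`), the fidelity formula
(11)–(12) and the approximate-simulability condition (1) of [QiEtAl2020], P-functions, and any
statement about sampling algorithms or their cost.

## References

* [OhEtAl2024] Nature Physics 20, 1461–1468 (2024), doi:10.1038/s41567-024-02535-8 = arXiv:2306.03709.
* [QiEtAl2020] Phys. Rev. Lett. 124, 100502 (2020), doi:10.1103/physrevlett.124.100502 = arXiv:1905.12075.
-/

noncomputable section

open Real Matrix Filter Topology

namespace Literature.Computability.QuantumComplexity

namespace LossySqueezedState

/-- Single-mode covariance matrices: real `2 × 2` matrices in the quadrature order `(x, p)`,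
`ħ = 2` (vacuum = identity). [cite: QiEtAl2020, p. 2 (ħ = 2, V_ρ)] [cite: OhEtAl2024, §VII.A eq. (20)] -/
abbrev Cov := Matrix (Fin 2) (Fin 2) ℝ

/-! ### Vocabulary -/

/-- Covariance matrix of the squeezed vacuum with squeezing parameter `r`:
`V_0 = diag(e^{2r}, e^{−2r})`. [cite: OhEtAl2024, App. B (B1)] -/
def sqzCov (r : ℝ) : Cov := diagonal ![exp (2 * r), exp (-(2 * r))]

/-- The pure-loss channel of transmission `η` on covariance matrices: `V ↦ ηV + (1 − η)1_2`.
[cite: OhEtAl2024, eq. (4) and App. B (B2)] -/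
def lossCov (η : ℝ) (V : Cov) : Cov := η • V + (1 - η) • (1 : Cov)

/-- `a₊ = ηe^{2r} + (1 − η)`, the anti-squeezed diagonal entry of the lossy squeezed state.
[cite: QiEtAl2020, SM §III before eq. (22)] [cite: OhEtAl2024, App. B (B2)] -/
def aPlus (η r : ℝ) : ℝ := η * exp (2 * r) + (1 - η)

/-- `a₋ = ηe^{−2r} + (1 − η)`, the squeezed diagonal entry of the lossy squeezed state.
[cite: QiEtAl2020, SM §III before eq. (22)] [cite: OhEtAl2024, App. B (B2)] -/
def aMinus (η r : ℝ) : ℝ := η * exp (-(2 * r)) + (1 - η)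

/-- Average photon number of a zero-mean single-mode state from its covariance matrix:
`Tr[V − 1_2]/4`. [cite: OhEtAl2024, §VII.A (after eq. (20))] -/
def meanPhoton (V : Cov) : ℝ := (V.trace - 2) / 4

/-- (t)-classicality: "`ρ` is (t)-classical if `V_ρ − tI_2` is positive definite"; `t = 1` is the
usual notion (regular Glauber–Sudarshan P function). [cite: QiEtAl2020, p. 2–3] -/
def IsTClassical (t : ℝ) (V : Cov) : Prop := (V - t • (1 : Cov)).PosDef

/-- `e^{2r} = (e^r)²`. [folklore] -/
private theorem exp_two_mul' (r : ℝ) : exp (2 * r) = exp r ^ 2 := by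
  rw [sq, ← Real.exp_add]; ring_nf

/-- `e^{−2r} = (e^r)⁻²`. [folklore] -/
private theorem exp_neg_two_mul' (r : ℝ) : exp (-(2 * r)) = (exp r ^ 2)⁻¹ := by
  rw [Real.exp_neg, exp_two_mul']

/-- **(B2)**: the lossy squeezed state is `diag(a₊, a₋)`.
[cite: OhEtAl2024, App. B (B2)] [cite: QiEtAl2020, SM §III ("V_σ = diag{a₊, a₋}")] -/
theorem lossCov_sqzCov (η r : ℝ) : lossCov η (sqzCov r) = diagonal ![aPlus η r, aMinus η r] := by
  ext i j
  fin_cases i <;> fin_cases j <;> simp [lossCov, sqzCov, aPlus, aMinus]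

/-- `a₊ > 0` for `0 ≤ η ≤ 1`. [cite: OhEtAl2024, App. B (B2)] -/
theorem aPlus_pos {η : ℝ} (hη0 : 0 ≤ η) (hη1 : η ≤ 1) (r : ℝ) : 0 < aPlus η r := by
  unfold aPlus
  rcases eq_or_lt_of_le hη0 with h | h
  · rw [← h]; norm_num
  · have := mul_pos h (exp_pos (2 * r)); linarith

/-- `a₋ > 0` for `0 ≤ η ≤ 1`. [cite: OhEtAl2024, App. B (B2)] -/
theorem aMinus_pos {η : ℝ} (hη0 : 0 ≤ η) (hη1 : η ≤ 1) (r : ℝ) : 0 < aMinus η r := by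
  unfold aMinus
  rcases eq_or_lt_of_le hη0 with h | h
  · rw [← h]; norm_num
  · have := mul_pos h (exp_pos (-(2 * r))); linarith

/-- **The key identity** behind `W ⪰ 0`, `n_th ≥ 0` and `t > s`:
`a₊ a₋ = 1 + η(1 − η)(e^r − e^{−r})²`. [cite: OhEtAl2024, App. B (B3)/(B8) (the quantity under
the square root of (B8))] -/
theorem aPlus_mul_aMinus (η r : ℝ) :
    aPlus η r * aMinus η r = 1 + η * (1 - η) * (exp r - exp (-r)) ^ 2 := by
  unfold aPlus aMinus
  rw [exp_two_mul', exp_neg_two_mul', Real.exp_neg]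
  have hu : exp r ≠ 0 := (exp_pos r).ne'
  field_simp
  ring

/-- `a₊ a₋ = 1 + 4η(1 − η) sinh² r`. [cite: OhEtAl2024, App. B (B8)] -/
theorem aPlus_mul_aMinus_eq_sinh (η r : ℝ) :
    aPlus η r * aMinus η r = 1 + 4 * η * (1 - η) * sinh r ^ 2 := by
  rw [aPlus_mul_aMinus, Real.sinh_eq]
  ring

/-- `a₊a₋ ≥ 1` for `0 ≤ η ≤ 1` (⇔ `W ⪰ 0` ⇔ `n_th ≥ 0` ⇔ `s ≤ t`). [cite: OhEtAl2024, App. B (B3), (B8)] -/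
theorem one_le_aPlus_mul_aMinus {η : ℝ} (hη0 : 0 ≤ η) (hη1 : η ≤ 1) (r : ℝ) :
    1 ≤ aPlus η r * aMinus η r := by
  rw [aPlus_mul_aMinus]
  have : 0 ≤ η * (1 - η) * (exp r - exp (-r)) ^ 2 :=
    mul_nonneg (mul_nonneg hη0 (by linarith)) (sq_nonneg _)
  linarith

/-- `a₊a₋ > 1` for `0 < η < 1` and `r ≠ 0` (⇔ `t > s`). [cite: OhEtAl2024, App. B (after (B8))] -/
theorem one_lt_aPlus_mul_aMinus {η : ℝ} (hη0 : 0 < η) (hη1 : η < 1) {r : ℝ} (hr : r ≠ 0) :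
    1 < aPlus η r * aMinus η r := by
  rw [aPlus_mul_aMinus]
  have hne : exp r - exp (-r) ≠ 0 := by
    intro h
    have : r = -r := Real.exp_injective (sub_eq_zero.mp h)
    exact hr (by linarith)
  have : 0 < η * (1 - η) * (exp r - exp (-r)) ^ 2 :=
    mul_pos (mul_pos hη0 (by linarith)) (sq_pos_iff.mpr hne)
  linarith

/-- For `r ≥ 0` and `η ≥ 0` the squeezed entry is the smaller one: `a₋ ≤ a₊`. [cite: OhEtAl2024,
App. B (B2) (r ≥ 0 "assumed nonnegative without loss of generality")] -/
theorem aMinus_le_aPlus {η : ℝ} (hη0 : 0 ≤ η) {r : ℝ} (hr : 0 ≤ r) : aMinus η r ≤ aPlus η r := by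
  unfold aPlus aMinus
  have h : exp (-(2 * r)) ≤ exp (2 * r) := Real.exp_le_exp.mpr (by linarith)
  nlinarith [mul_le_mul_of_nonneg_left h hη0]

/-- Under pure loss the squeezed entry stays at most `1`: `a₋ ≤ 1` for `r ≥ 0`, `η ≥ 0`.
[cite: OhEtAl2024, App. B (B3) (s ≥ 0)] -/
theorem aMinus_le_one {η : ℝ} (hη0 : 0 ≤ η) {r : ℝ} (hr : 0 ≤ r) : aMinus η r ≤ 1 := by
  unfold aMinus
  have h : exp (-(2 * r)) ≤ 1 := Real.exp_le_one_iff.mpr (by linarith)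
  nlinarith [mul_le_mul_of_nonneg_left h hη0]

/-- … and strictly below `1` as soon as `η > 0` and `r > 0`. [cite: QiEtAl2020, p. 2 ("a squeezed
state, under the effect of pure loss, never becomes exactly a classical state")] -/
theorem aMinus_lt_one {η : ℝ} (hη0 : 0 < η) {r : ℝ} (hr : 0 < r) : aMinus η r < 1 := by
  unfold aMinus
  have h : exp (-(2 * r)) < 1 := Real.exp_lt_one_iff.mpr (by linarith)
  nlinarith [mul_lt_mul_of_pos_left h hη0]

/-- `a₋ ≥ 1 − η` (the `r → ∞` floor of the squeezed entry). [cite: OhEtAl2024, p. 4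
("s = −1/2 log(1 − η)" in the limit r → ∞)] -/
theorem one_sub_le_aMinus {η : ℝ} (hη0 : 0 ≤ η) (r : ℝ) : 1 - η ≤ aMinus η r := by
  unfold aMinus
  have := mul_nonneg hη0 (exp_pos (-(2 * r))).le
  linarith

/-! ### The decomposition `V = V_p + W` (eq. (5) / (B3)) -/

/-- The **actual squeezing parameter** `s` of the lossy squeezed state, defined by
`e^{−2s} ≡ ηe^{−2r} + (1 − η)`, i.e. `s = −½ log a₋`. [cite: OhEtAl2024, eq. (5) and App. B (B3)] -/
def actualSqueezing (η r : ℝ) : ℝ := -(1 / 2) * log (aMinus η r)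

/-- `e^{−2s} = ηe^{−2r} + 1 − η`. [cite: OhEtAl2024, eq. (5) ("e^{−2s} ≡ ηe^{−2r} + (1 − η)")] -/
theorem exp_neg_two_mul_actualSqueezing {η : ℝ} (hη0 : 0 ≤ η) (hη1 : η ≤ 1) (r : ℝ) :
    exp (-(2 * actualSqueezing η r)) = aMinus η r := by
  unfold actualSqueezing
  rw [show -(2 * (-(1 / 2) * log (aMinus η r))) = log (aMinus η r) by ring,
    Real.exp_log (aMinus_pos hη0 hη1 r)]

/-- `e^{2s} = 1/(ηe^{−2r} + 1 − η)`. [cite: OhEtAl2024, eq. (5)] -/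
theorem exp_two_mul_actualSqueezing {η : ℝ} (hη0 : 0 ≤ η) (hη1 : η ≤ 1) (r : ℝ) :
    exp (2 * actualSqueezing η r) = (aMinus η r)⁻¹ := by
  rw [← exp_neg_two_mul_actualSqueezing hη0 hη1 r, ← Real.exp_neg, neg_neg]

/-- The **classical part** `W = diag(ηe^{2r} + 1 − η − e^{2s}, 0)` (a Gaussian random displacement
of the `x` quadrature). [cite: OhEtAl2024, eq. (5) and App. B (B3)] -/
def displacementNoise (η r : ℝ) : Cov :=
  diagonal ![aPlus η r - exp (2 * actualSqueezing η r), 0]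

/-- **The decomposition (5)/(B3)**: `ηV_0 + (1 − η)1 = V_p + W` with `V_p` the covariance matrix of
the squeezed vacuum of squeezing `s` and `W` the displacement noise.
[cite: OhEtAl2024, eq. (4)–(5); App. B (B2)–(B3)] -/
theorem lossCov_sqzCov_eq_sqzCov_add_displacementNoise {η : ℝ} (hη0 : 0 ≤ η) (hη1 : η ≤ 1)
    (r : ℝ) :
    lossCov η (sqzCov r) = sqzCov (actualSqueezing η r) + displacementNoise η r := by
  rw [lossCov_sqzCov, sqzCov, displacementNoise, exp_neg_two_mul_actualSqueezing hη0 hη1,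
    diagonal_add]
  congr 1
  funext i
  fin_cases i <;> simp

/-- The `(x, x)` entry of `W` in closed form: `W₀₀ = a₊ − 1/a₋`. [cite: OhEtAl2024, App. B (B3)] -/
theorem displacementNoise_apply_zero {η : ℝ} (hη0 : 0 ≤ η) (hη1 : η ≤ 1) (r : ℝ) :
    displacementNoise η r 0 0 = aPlus η r - (aMinus η r)⁻¹ := by
  simp [displacementNoise, exp_two_mul_actualSqueezing hη0 hη1]

/-- "`W`'s first matrix element is nonnegative" — for EVERY real `r` once `0 ≤ η ≤ 1` (the source
assumes `r ≥ 0`; the sign of `r` only decides which quadrature is squeezed). It is the inequality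
`a₊a₋ ≥ 1` of `one_le_aPlus_mul_aMinus`. [cite: OhEtAl2024, App. B (after (B3))] -/
theorem displacementNoise_apply_zero_nonneg {η : ℝ} (hη0 : 0 ≤ η) (hη1 : η ≤ 1) (r : ℝ) :
    0 ≤ displacementNoise η r 0 0 := by
  rw [displacementNoise_apply_zero hη0 hη1, sub_nonneg, inv_eq_one_div,
    div_le_iff₀ (aMinus_pos hη0 hη1 r)]
  exact one_le_aPlus_mul_aMinus hη0 hη1 r

/-- **`W ⪰ 0`.** [cite: OhEtAl2024, §III.A ("W ⪰ 0") and App. B (B3)] -/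
theorem posSemidef_displacementNoise {η : ℝ} (hη0 : 0 ≤ η) (hη1 : η ≤ 1) (r : ℝ) :
    (displacementNoise η r).PosSemidef := by
  have h0 := displacementNoise_apply_zero_nonneg hη0 hη1 r
  simp only [displacementNoise, diagonal_apply_eq, Matrix.cons_val_zero] at h0
  rw [displacementNoise, posSemidef_diagonal_iff]
  intro i
  fin_cases i
  · simpa using h0
  · simp

/-- `V_p` is the covariance matrix of a PURE state: `det V_p = 1`. [cite: OhEtAl2024, §III.A
("V_p represents the covariance matrix of a pure Gaussian state")] -/
theorem det_sqzCov (r : ℝ) : (sqzCov r).det = 1 := by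
  rw [sqzCov, det_diagonal, Fin.prod_univ_two]
  simp only [Matrix.cons_val_zero, Matrix.cons_val_one]
  rw [← Real.exp_add]
  simp

/-- `s ≥ 0` for `r ≥ 0`. [cite: OhEtAl2024, p. 4 ("the resultant (smaller) squeezing parameter
s ≥ 0 of V_p")] -/
theorem actualSqueezing_nonneg {η : ℝ} (hη0 : 0 ≤ η) (hη1 : η ≤ 1) {r : ℝ} (hr : 0 ≤ r) :
    0 ≤ actualSqueezing η r := by
  unfold actualSqueezing
  have := Real.log_nonpos (aMinus_pos hη0 hη1 r).le (aMinus_le_one hη0 hr)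
  linarith

/-- `s > 0` for `r > 0`, `η > 0`. [cite: OhEtAl2024, Fig. 2(a)] -/
theorem actualSqueezing_pos {η : ℝ} (hη0 : 0 < η) (hη1 : η ≤ 1) {r : ℝ} (hr : 0 < r) :
    0 < actualSqueezing η r := by
  unfold actualSqueezing
  have := Real.log_neg (aMinus_pos hη0.le hη1 r) (aMinus_lt_one hη0 hr)
  linarith

/-- **`s ≤ r`**: loss only REDUCES the squeezing ("the resultant (smaller) squeezing parameter").
[cite: OhEtAl2024, p. 4 and Fig. 2(a)] -/
theorem actualSqueezing_le {η : ℝ} (hη1 : η ≤ 1) {r : ℝ} (hr : 0 ≤ r) :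
    actualSqueezing η r ≤ r := by
  unfold actualSqueezing
  have hle : exp (-(2 * r)) ≤ aMinus η r := by
    unfold aMinus
    have h1 : exp (-(2 * r)) ≤ 1 := Real.exp_le_one_iff.mpr (by linarith)
    nlinarith
  have := Real.log_le_log (exp_pos _) hle
  rw [Real.log_exp] at this
  linarith

/-- With perfect transmission nothing is lost: `s = r` at `η = 1`. [cite: OhEtAl2024, Fig. 2(a)] -/
theorem actualSqueezing_one (r : ℝ) : actualSqueezing 1 r = r := by
  simp [actualSqueezing, aMinus, Real.log_exp]

/-- With zero transmission nothing survives: `s = 0` at `η = 0`. [cite: OhEtAl2024, Fig. 2(a)] -/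
theorem actualSqueezing_zero_left (r : ℝ) : actualSqueezing 0 r = 0 := by
  simp [actualSqueezing, aMinus]

/-- **The `r → ∞` ceiling**: `s ≤ −½ log(1 − η)` for every input squeezing ("even if the input
squeezing is infinite … the actual squeezing is only `s = −1/2 log(1 − η)`").
[cite: OhEtAl2024, p. 4 and Fig. 2(c)] -/
theorem actualSqueezing_le_limit {η : ℝ} (hη0 : 0 ≤ η) (hη1 : η < 1) (r : ℝ) :
    actualSqueezing η r ≤ -(1 / 2) * log (1 - η) := by
  unfold actualSqueezing
  have := Real.log_le_log (by linarith : 0 < 1 - η) (one_sub_le_aMinus hη0 r)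
  linarith

/-- … and the ceiling is attained in the limit: `s → −½ log(1 − η)` as `r → ∞`.
[cite: OhEtAl2024, p. 4 ("r → ∞, the actual squeezing is only s = −1/2 log(1 − η)")] -/
theorem tendsto_actualSqueezing_atTop {η : ℝ} (hη1 : η < 1) :
    Tendsto (actualSqueezing η) atTop (𝓝 (-(1 / 2) * log (1 - η))) := by
  have h2 : Tendsto (fun r : ℝ => -(2 * r)) atTop atBot :=
    tendsto_neg_atTop_atBot.comp (tendsto_id.const_mul_atTop (by norm_num : (0 : ℝ) < 2))
  have hexp : Tendsto (fun r : ℝ => exp (-(2 * r))) atTop (𝓝 0) :=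
    Real.tendsto_exp_atBot.comp h2
  have ha : Tendsto (aMinus η) atTop (𝓝 (η * 0 + (1 - η))) :=
    (hexp.const_mul η).add_const (1 - η)
  rw [mul_zero, zero_add] at ha
  have hlog : Tendsto (fun r => log (aMinus η r)) atTop (𝓝 (log (1 - η))) :=
    (Real.continuousAt_log (by linarith : (1 - η) ≠ 0)).tendsto.comp ha
  exact hlog.const_mul _

/-- `s` is monotone in the input squeezing `r` (for `0 ≤ η ≤ 1`). [cite: OhEtAl2024, Fig. 2(a)] -/
theorem actualSqueezing_mono {η : ℝ} (hη0 : 0 ≤ η) (hη1 : η ≤ 1) :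
    Monotone (actualSqueezing η) := by
  intro r₁ r₂ h
  unfold actualSqueezing
  have hle : aMinus η r₂ ≤ aMinus η r₁ := by
    unfold aMinus
    have : exp (-(2 * r₂)) ≤ exp (-(2 * r₁)) := Real.exp_le_exp.mpr (by linarith)
    nlinarith [mul_le_mul_of_nonneg_left this hη0]
  have := Real.log_le_log (aMinus_pos hη0 hη1 r₂) hle
  linarith

/-- `s` is monotone in the transmission `η` on `[0, 1]` (for `r ≥ 0`): "the importance of improving
the transmission rate to increase quantum resources". [cite: OhEtAl2024, p. 4 and Fig. 2(a)] -/
theorem actualSqueezing_mono_left {r : ℝ} (hr : 0 ≤ r) :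
    MonotoneOn (fun η => actualSqueezing η r) (Set.Icc 0 1) := by
  intro η₁ h₁ η₂ h₂ h
  simp only [actualSqueezing]
  have hle : aMinus η₂ r ≤ aMinus η₁ r := by
    unfold aMinus
    have : exp (-(2 * r)) ≤ 1 := Real.exp_le_one_iff.mpr (by linarith)
    nlinarith
  have := Real.log_le_log (aMinus_pos h₂.1 h₂.2 r) hle
  linarith

/-! ### Photon bookkeeping (§VII.A with (B3)) -/

/-- `Tr[diag(a, b) − 1_2]/4 = (a + b − 2)/4`. [cite: OhEtAl2024, §VII.A (after eq. (20))] -/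
theorem meanPhoton_diagonal (a b : ℝ) : meanPhoton (diagonal ![a, b]) = (a + b - 2) / 4 := by
  simp [meanPhoton]

/-- The squeezed vacuum of squeezing `s` carries `sinh² s` photons ("actual squeezed photons …
`Tr[V_p − 1_{2M}]/4`"). [cite: OhEtAl2024, p. 3–4 (Table I caption, "actual squeezed photons")
and §VII.A] -/
theorem meanPhoton_sqzCov (s : ℝ) : meanPhoton (sqzCov s) = sinh s ^ 2 := by
  rw [sqzCov, meanPhoton_diagonal, Real.sinh_eq, exp_two_mul', exp_neg_two_mul', Real.exp_neg]
  have hu : exp s ≠ 0 := (exp_pos s).ne'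
  field_simp
  ring

/-- The lossy squeezed state carries `η sinh² r` photons (the "output photons" of Table I).
[cite: OhEtAl2024, §VII.A with App. B (B2)] -/
theorem meanPhoton_lossCov_sqzCov (η r : ℝ) : meanPhoton (lossCov η (sqzCov r)) = η * sinh r ^ 2 := by
  rw [lossCov_sqzCov, meanPhoton_diagonal, aPlus, aMinus, Real.sinh_eq, exp_two_mul',
    exp_neg_two_mul', Real.exp_neg]
  have hu : exp r ≠ 0 := (exp_pos r).ne'
  field_simp
  ring

/-- **"The proposed decomposition separates the output photons into two contributions"**:
`η sinh² r = sinh² s + W₀₀/4` — the quantum resource (actual squeezed photons) plus the classical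
resource (thermal photons of the random displacement). [cite: OhEtAl2024, p. 4] -/
theorem meanPhoton_lossCov_sqzCov_eq_add {η : ℝ} (hη0 : 0 ≤ η) (hη1 : η ≤ 1) (r : ℝ) :
    meanPhoton (lossCov η (sqzCov r)) =
      sinh (actualSqueezing η r) ^ 2 + displacementNoise η r 0 0 / 4 := by
  rw [← meanPhoton_sqzCov, lossCov_sqzCov_eq_sqzCov_add_displacementNoise hη0 hη1]
  simp [meanPhoton, Matrix.trace_fin_two, displacementNoise]
  ring

/-- Hence the actual squeezed photons never exceed the output photons: `sinh² s ≤ η sinh² r`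
(Table I, column 'Ratio' ≤ 1). [cite: OhEtAl2024, Table I and p. 4] -/
theorem sinh_sq_actualSqueezing_le {η : ℝ} (hη0 : 0 ≤ η) (hη1 : η ≤ 1) (r : ℝ) :
    sinh (actualSqueezing η r) ^ 2 ≤ η * sinh r ^ 2 := by
  rw [← meanPhoton_lossCov_sqzCov, meanPhoton_lossCov_sqzCov_eq_add hη0 hη1]
  have := displacementNoise_apply_zero_nonneg hη0 hη1 r
  linarith

/-! ### The squeezed-thermal (Williamson) form (B4)–(B8) = SM (20), (22), (23) -/

/-- Covariance matrix of the squeezed thermal state with squeezing `s` and `n` thermal photons,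
squeezing axes along the quadratures: `(2n + 1) diag(e^{2s}, e^{−2s})` (SM (20) at `φ = π`;
(B4)–(B6) with `t = s`, `n_th = n`). [cite: QiEtAl2020, SM §III eq. (20)]
[cite: OhEtAl2024, App. B (B4)–(B6)] -/
def stsCov (s n : ℝ) : Cov := (2 * n + 1) • diagonal ![exp (2 * s), exp (-(2 * s))]

/-- (B6) regrouped: `V_STS = (2n + 1)·diag(e^{2s}, e^{−2s})`. [cite: OhEtAl2024, App. B (B4)–(B6)] -/
theorem stsCov_eq_smul_sqzCov (s n : ℝ) : stsCov s n = (2 * n + 1) • sqzCov s := rfl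

/-- (B4): the sandwich form `S_t (2n + 1)1 S_t` with `S_t = diag(e^t, e^{−t})`.
[cite: OhEtAl2024, App. B (B4)–(B6)] -/
theorem stsCov_eq_sandwich (s n : ℝ) :
    stsCov s n = diagonal ![exp s, exp (-s)] * ((2 * n + 1) • (1 : Cov)) * diagonal ![exp s, exp (-s)] := by
  rw [Matrix.mul_smul, Matrix.mul_one, Matrix.smul_mul, diagonal_mul_diagonal, stsCov]
  congr 1
  ext i j
  fin_cases i <;> fin_cases j <;> simp [← Real.exp_add] <;> ring_nf

/-- A thermal state (`s = 0`) has covariance `(2n + 1)·1`. [cite: QiEtAl2020, SM §III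
("its covariance matrix is given by (2n_ρ + 1)I_2")] -/
theorem stsCov_zero_left (n : ℝ) : stsCov 0 n = (2 * n + 1) • (1 : Cov) := by
  rw [stsCov]
  congr 1
  ext i j
  fin_cases i <;> fin_cases j <;> simp

/-- The Williamson squeezing parameter `t = ¼ log(a₊/a₋)` of (B7) (= `s_σ` of SM (22)).
[cite: OhEtAl2024, App. B (B7)] [cite: QiEtAl2020, SM §III eq. (22)] -/
def williamsonSqueezing (η r : ℝ) : ℝ := 1 / 4 * log (aPlus η r / aMinus η r)

/-- The thermal photon number `n_th = ½(√(a₊a₋) − 1)` of (B8) (= `n_σ` of SM (23)).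
[cite: OhEtAl2024, App. B (B8)] [cite: QiEtAl2020, SM §III eq. (23)] -/
def thermalPhotons (η r : ℝ) : ℝ := 1 / 2 * (Real.sqrt (aPlus η r * aMinus η r) - 1)

/-- `2n_th + 1 = √(a₊a₋)` (the symplectic eigenvalue). [cite: OhEtAl2024, App. B (B8)] -/
theorem two_mul_thermalPhotons_add_one (η r : ℝ) :
    2 * thermalPhotons η r + 1 = Real.sqrt (aPlus η r * aMinus η r) := by
  unfold thermalPhotons; ring

/-- `n_th ≥ 0` (equivalently `a₊a₋ ≥ 1`, the single-mode uncertainty relation).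
[cite: OhEtAl2024, App. B (B8)] -/
theorem thermalPhotons_nonneg {η : ℝ} (hη0 : 0 ≤ η) (hη1 : η ≤ 1) (r : ℝ) :
    0 ≤ thermalPhotons η r := by
  unfold thermalPhotons
  have : 1 ≤ Real.sqrt (aPlus η r * aMinus η r) := by
    rw [Real.le_sqrt' one_pos, one_pow]
    exact one_le_aPlus_mul_aMinus hη0 hη1 r
  linarith

/-- `n_th = 0` (the lossy state is pure) at perfect transmission. [cite: OhEtAl2024, App. B (B8)] -/
theorem thermalPhotons_one (r : ℝ) : thermalPhotons 1 r = 0 := by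
  have h : aPlus 1 r * aMinus 1 r = 1 := by rw [aPlus_mul_aMinus]; ring
  simp [thermalPhotons, h]

/-- `e^{2t} = √(a₊/a₋)`. [cite: OhEtAl2024, App. B (B7)] -/
theorem exp_two_mul_williamsonSqueezing {η : ℝ} (hη0 : 0 ≤ η) (hη1 : η ≤ 1) (r : ℝ) :
    exp (2 * williamsonSqueezing η r) = Real.sqrt (aPlus η r / aMinus η r) := by
  have hpos : 0 < aPlus η r / aMinus η r := div_pos (aPlus_pos hη0 hη1 r) (aMinus_pos hη0 hη1 r)
  unfold williamsonSqueezing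
  rw [show 2 * (1 / 4 * log (aPlus η r / aMinus η r)) = log (aPlus η r / aMinus η r) / 2 by ring,
    ← Real.log_sqrt hpos.le, Real.exp_log (Real.sqrt_pos.mpr hpos)]

/-- `e^{−2t} = √(a₋/a₊)`. [cite: OhEtAl2024, App. B (B7)] -/
theorem exp_neg_two_mul_williamsonSqueezing {η : ℝ} (hη0 : 0 ≤ η) (hη1 : η ≤ 1) (r : ℝ) :
    exp (-(2 * williamsonSqueezing η r)) = Real.sqrt (aMinus η r / aPlus η r) := by
  rw [Real.exp_neg, exp_two_mul_williamsonSqueezing hη0 hη1, ← Real.sqrt_inv, inv_div]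

/-- **(B4)–(B8) / SM (22)–(23)**: the lossy squeezed state IS the squeezed thermal state with
squeezing `t` and `n_th` thermal photons: `diag(a₊, a₋) = (2n_th + 1) diag(e^{2t}, e^{−2t})`.
[cite: OhEtAl2024, App. B (B4)–(B8)] [cite: QiEtAl2020, SM §III eq. (20), (22), (23)] -/
theorem lossCov_sqzCov_eq_stsCov {η : ℝ} (hη0 : 0 ≤ η) (hη1 : η ≤ 1) (r : ℝ) :
    lossCov η (sqzCov r) = stsCov (williamsonSqueezing η r) (thermalPhotons η r) := by
  have hP := aPlus_pos hη0 hη1 r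
  have hM := aMinus_pos hη0 hη1 r
  have hP' := hP.ne'
  have hM' := hM.ne'
  have e1 : Real.sqrt (aPlus η r * aMinus η r) * Real.sqrt (aPlus η r / aMinus η r) = aPlus η r := by
    rw [← Real.sqrt_mul (mul_pos hP hM).le,
      show aPlus η r * aMinus η r * (aPlus η r / aMinus η r) = aPlus η r ^ 2 by field_simp,
      Real.sqrt_sq hP.le]
  have e2 : Real.sqrt (aPlus η r * aMinus η r) * Real.sqrt (aMinus η r / aPlus η r) = aMinus η r := by
    rw [← Real.sqrt_mul (mul_pos hP hM).le,
      show aPlus η r * aMinus η r * (aMinus η r / aPlus η r) = aMinus η r ^ 2 by field_simp,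
      Real.sqrt_sq hM.le]
  rw [stsCov, two_mul_thermalPhotons_add_one, exp_two_mul_williamsonSqueezing hη0 hη1,
    exp_neg_two_mul_williamsonSqueezing hη0 hη1, lossCov_sqzCov]
  ext i j
  fin_cases i <;> fin_cases j <;> simp [e1, e2]

/-- `det V = a₊a₋ = (2n_th + 1)²` — for these diagonal single-mode matrices the uncertainty relation
`V ⪰ iΩ` is `det V ≥ 1`. [cite: OhEtAl2024, §VII.A eq. (20) and App. B (B8)] -/
theorem det_lossCov_sqzCov (η r : ℝ) : (lossCov η (sqzCov r)).det = aPlus η r * aMinus η r := by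
  rw [lossCov_sqzCov, det_diagonal, Fin.prod_univ_two]
  simp

/-- `det V = (2n_th + 1)²`. [cite: OhEtAl2024, App. B (B4), (B8)] -/
theorem det_lossCov_sqzCov_eq_sq {η : ℝ} (hη0 : 0 ≤ η) (hη1 : η ≤ 1) (r : ℝ) :
    (lossCov η (sqzCov r)).det = (2 * thermalPhotons η r + 1) ^ 2 := by
  rw [det_lossCov_sqzCov, two_mul_thermalPhotons_add_one,
    Real.sq_sqrt (mul_pos (aPlus_pos hη0 hη1 r) (aMinus_pos hη0 hη1 r)).le]

/-- `det V ≥ 1` for the lossy squeezed state. [cite: OhEtAl2024, §VII.A eq. (20) (physicality)] -/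
theorem one_le_det_lossCov_sqzCov {η : ℝ} (hη0 : 0 ≤ η) (hη1 : η ≤ 1) (r : ℝ) :
    1 ≤ (lossCov η (sqzCov r)).det := by
  rw [det_lossCov_sqzCov]; exact one_le_aPlus_mul_aMinus hη0 hη1 r

/-- `t − s = ¼ log(a₊a₋)`: the two squeezing parameters differ by a quarter of the log of the
symplectic invariant. [cite: OhEtAl2024, App. B (B3), (B7)] -/
theorem williamsonSqueezing_sub_actualSqueezing {η : ℝ} (hη0 : 0 ≤ η) (hη1 : η ≤ 1) (r : ℝ) :
    williamsonSqueezing η r - actualSqueezing η r = 1 / 4 * log (aPlus η r * aMinus η r) := by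
  unfold williamsonSqueezing actualSqueezing
  rw [Real.log_div (aPlus_pos hη0 hη1 r).ne' (aMinus_pos hη0 hη1 r).ne',
    Real.log_mul (aPlus_pos hη0 hη1 r).ne' (aMinus_pos hη0 hη1 r).ne']
  ring

/-- `s ≤ t` always. [cite: OhEtAl2024, App. B ("One can easily show that t > s")] -/
theorem actualSqueezing_le_williamsonSqueezing {η : ℝ} (hη0 : 0 ≤ η) (hη1 : η ≤ 1) (r : ℝ) :
    actualSqueezing η r ≤ williamsonSqueezing η r := by
  have h := williamsonSqueezing_sub_actualSqueezing hη0 hη1 r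
  have : 0 ≤ log (aPlus η r * aMinus η r) := Real.log_nonneg (one_le_aPlus_mul_aMinus hη0 hη1 r)
  linarith

/-- **`t > s`** for a genuinely lossy (`0 < η < 1`), genuinely squeezed (`r ≠ 0`) input: "our
minimization gives a smaller photon number for the quantum part" than the Williamson decomposition
of Ref. [30]. [cite: OhEtAl2024, App. B (after (B8))] -/
theorem actualSqueezing_lt_williamsonSqueezing {η : ℝ} (hη0 : 0 < η) (hη1 : η < 1) {r : ℝ}
    (hr : r ≠ 0) : actualSqueezing η r < williamsonSqueezing η r := by
  have h := williamsonSqueezing_sub_actualSqueezing hη0.le hη1.le r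
  have : 0 < log (aPlus η r * aMinus η r) := Real.log_pos (one_lt_aPlus_mul_aMinus hη0 hη1 hr)
  linarith

/-- … hence strictly fewer photons in the quantum part: `sinh² s < sinh² t` (for `r > 0`).
[cite: OhEtAl2024, App. B (after (B8))] -/
theorem sinh_sq_actualSqueezing_lt {η : ℝ} (hη0 : 0 < η) (hη1 : η < 1) {r : ℝ} (hr : 0 < r) :
    sinh (actualSqueezing η r) ^ 2 < sinh (williamsonSqueezing η r) ^ 2 := by
  have hs : 0 ≤ sinh (actualSqueezing η r) :=
    Real.sinh_nonneg_iff.mpr (actualSqueezing_nonneg hη0.le hη1.le hr.le)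
  have hlt : sinh (actualSqueezing η r) < sinh (williamsonSqueezing η r) :=
    Real.sinh_strictMono (actualSqueezing_lt_williamsonSqueezing hη0 hη1 hr.ne')
  exact pow_lt_pow_left₀ hlt hs two_ne_zero

/-! ### (t)-classicality ([QiEtAl2020]) -/

/-- A diagonal covariance matrix is (t)-classical iff both entries exceed `t`.
[cite: QiEtAl2020, p. 2–3 (definition) and SM §III eq. (21)] -/
theorem isTClassical_diagonal_iff (t a b : ℝ) :
    IsTClassical t (diagonal ![a, b]) ↔ t < a ∧ t < b := by
  have h : diagonal ![a, b] - t • (1 : Cov) = diagonal ![a - t, b - t] := by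
    ext i j
    fin_cases i <;> fin_cases j <;> simp [sub_eq_add_neg]
  rw [IsTClassical, h, posDef_diagonal_iff, Fin.forall_fin_two]
  simp [sub_pos]

/-- The vacuum / any state is never (t)-classical beyond its smallest entry; in particular the
identity (vacuum, `ħ = 2`) is (t)-classical exactly for `t < 1`. [cite: QiEtAl2020, p. 2
("there always exists t*_ρ ∈ [0, 1] …")] -/
theorem isTClassical_one_iff (t : ℝ) : IsTClassical t (1 : Cov) ↔ t < 1 := by
  have h : (1 : Cov) = diagonal ![1, 1] := by
    ext i j; fin_cases i <;> fin_cases j <;> simp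
  rw [h, isTClassical_diagonal_iff, and_self]

/-- **SM (21)**: the squeezed thermal state (`s ≥ 0`, `n ≥ 0`) is (t)-classical iff
`t < (2n + 1)e^{−2s}`. [cite: QiEtAl2020, SM §III eq. (20)–(21)] -/
theorem isTClassical_stsCov_iff {s n : ℝ} (hs : 0 ≤ s) (hn : 0 ≤ n) (t : ℝ) :
    IsTClassical t (stsCov s n) ↔ t < (2 * n + 1) * exp (-(2 * s)) := by
  have h : stsCov s n = diagonal ![(2 * n + 1) * exp (2 * s), (2 * n + 1) * exp (-(2 * s))] := by
    rw [stsCov, ← diagonal_smul]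
    congr 1; funext i; fin_cases i <;> simp
  rw [h, isTClassical_diagonal_iff]
  constructor
  · exact fun h => h.2
  · intro ht
    refine ⟨lt_of_lt_of_le ht ?_, ht⟩
    have : exp (-(2 * s)) ≤ exp (2 * s) := Real.exp_le_exp.mpr (by linarith)
    exact mul_le_mul_of_nonneg_left this (by linarith)

/-- **SM (21) in the printed form**: for `t > 0`, (t)-classical iff `s < ½ ln((2n + 1)/t)` (the
source writes `≤`; at equality `V − tI_2` is singular, the δ-function case of the (t)-PQD).
[cite: QiEtAl2020, SM §III eq. (21) and p. 4 ("s_τ ≤ ½ ln((2n_τ + 1)/t)")] -/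
theorem isTClassical_stsCov_iff_lt_log {s n t : ℝ} (hs : 0 ≤ s) (hn : 0 ≤ n) (ht : 0 < t) :
    IsTClassical t (stsCov s n) ↔ s < 1 / 2 * log ((2 * n + 1) / t) := by
  rw [isTClassical_stsCov_iff hs hn]
  have h2n : 0 < 2 * n + 1 := by linarith
  have hpos : 0 < t / (2 * n + 1) := div_pos ht h2n
  rw [← div_lt_iff₀' h2n, ← Real.log_lt_iff_lt_exp hpos, Real.log_div ht.ne' h2n.ne',
    Real.log_div h2n.ne' ht.ne']
  constructor <;> intro h <;> linarith

/-- The lossy squeezed state (`r ≥ 0`, `η ≥ 0`) is (t)-classical iff `t < a₋ = ηe^{−2r} + 1 − η`.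
[cite: QiEtAl2020, p. 2–3 and SM §III ("V_σ = diag{a₊, a₋}")] -/
theorem isTClassical_lossCov_sqzCov_iff {η : ℝ} (hη0 : 0 ≤ η) {r : ℝ} (hr : 0 ≤ r) (t : ℝ) :
    IsTClassical t (lossCov η (sqzCov r)) ↔ t < aMinus η r := by
  rw [lossCov_sqzCov, isTClassical_diagonal_iff]
  exact ⟨fun h => h.2, fun h => ⟨lt_of_lt_of_le h (aMinus_le_aPlus hη0 hr), h⟩⟩

/-- **"A squeezed state, under the effect of pure loss, never becomes exactly a classical state"**
(`η > 0`, `r > 0`). [cite: QiEtAl2020, p. 2] -/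
theorem not_isTClassical_one_lossCov_sqzCov {η : ℝ} (hη0 : 0 < η) {r : ℝ} (hr : 0 < r) :
    ¬ IsTClassical 1 (lossCov η (sqzCov r)) := by
  rw [isTClassical_lossCov_sqzCov_iff hη0.le hr.le, not_lt]
  exact (aMinus_lt_one hη0 hr).le

/-- **"… though it approximates one arbitrarily well"**: it is (t)-classical for a given `t` exactly
when `η(1 − e^{−2r}) < 1 − t`; in particular for every `t < 1` once the transmission is small
enough, and for `t < 1 − η` whatever the squeezing. [cite: QiEtAl2020, p. 2] -/
theorem isTClassical_lossCov_sqzCov_iff_lt {η : ℝ} (hη0 : 0 ≤ η) {r : ℝ} (hr : 0 ≤ r) (t : ℝ) :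
    IsTClassical t (lossCov η (sqzCov r)) ↔ η * (1 - exp (-(2 * r))) < 1 - t := by
  rw [isTClassical_lossCov_sqzCov_iff hη0 hr, aMinus]
  constructor <;> intro h <;> linarith

/-- For `t < 1 − η` the lossy squeezed state is (t)-classical whatever the squeezing (both entries
are `≥ 1 − η`). [cite: QiEtAl2020, p. 2 ("approximates one arbitrarily well")] -/
theorem isTClassical_lossCov_sqzCov_of_lt {η t : ℝ} (hη0 : 0 ≤ η) (ht : t < 1 - η) (r : ℝ) :
    IsTClassical t (lossCov η (sqzCov r)) := by
  rw [lossCov_sqzCov, isTClassical_diagonal_iff]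
  have h1 := one_sub_le_aMinus hη0 r
  have h2 : 1 - η ≤ aPlus η r := by
    unfold aPlus; have := mul_nonneg hη0 (exp_pos (2 * r)).le; linarith
  exact ⟨lt_of_lt_of_le ht h2, lt_of_lt_of_le ht h1⟩

/-- The printed threshold transmission `η∞ := q_D(1 + coth r)` (`q_D = p_D/η_D` the detector figure
of merit), written with `coth r = cosh r / sinh r`. [cite: QiEtAl2020, eq. (2)] -/
def etaInfinity (q r : ℝ) : ℝ := q * (1 + cosh r / sinh r)

/-- `1 + coth r = 2/(1 − e^{−2r})` (`r ≠ 0`). [cite: QiEtAl2020, eq. (2)] -/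
theorem one_add_coth_eq {r : ℝ} (hr : r ≠ 0) : 1 + cosh r / sinh r = 2 / (1 - exp (-(2 * r))) := by
  have hu : 0 < exp r := exp_pos r
  have hu1 : exp r ^ 2 ≠ 1 := by
    intro h
    have h1 : exp r = 1 := (pow_eq_one_iff_of_nonneg hu.le two_ne_zero).mp h
    exact hr ((Real.exp_eq_one_iff r).mp h1)
  have hd : exp r ^ 2 - 1 ≠ 0 := sub_ne_zero.mpr hu1
  have hc : cosh r = (exp r ^ 2 + 1) / (2 * exp r) := by
    rw [Real.cosh_eq, Real.exp_neg]; field_simp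
  have hs : sinh r = (exp r ^ 2 - 1) / (2 * exp r) := by
    rw [Real.sinh_eq, Real.exp_neg]; field_simp
  have h2 : (1 : ℝ) - (exp r ^ 2)⁻¹ = (exp r ^ 2 - 1) / exp r ^ 2 := by
    field_simp
  rw [hc, hs, div_div_div_cancel_right₀ (by positivity : (2 * exp r) ≠ 0), one_add_div hd,
    exp_neg_two_mul', h2, div_div_eq_mul_div]
  congr 1
  ring

/-- **The exact-sampling threshold of Ref. [11] is the `(1 − 2q_D)`-classicality of the lossy
squeezed state**: for `r > 0`, `η ≥ 0`, the state `diag(a₊, a₋)` is `(1 − 2q)`-classical iff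
`η < η∞ = q(1 + coth r)` ("η < η∞ is the corresponding condition that follows for exact sampling
(ε = 0)"; "simulated exactly … if τ is a (t)-classical state, for t ∈ [1 − 2q_D, 1]"). With
`q = 0` the condition is `η < 0`, i.e. never ("inequality (1) gives trivial result η < 0").
[cite: QiEtAl2020, eq. (2) and p. 2–3] -/
theorem isTClassical_lossCov_sqzCov_iff_lt_etaInfinity {η : ℝ} (hη0 : 0 ≤ η) {r : ℝ} (hr : 0 < r)
    (q : ℝ) : IsTClassical (1 - 2 * q) (lossCov η (sqzCov r)) ↔ η < etaInfinity q r := by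
  rw [isTClassical_lossCov_sqzCov_iff_lt hη0 hr.le, etaInfinity, one_add_coth_eq hr.ne']
  have hpos : 0 < 1 - exp (-(2 * r)) := by
    have : exp (-(2 * r)) < 1 := Real.exp_lt_one_iff.mpr (by linarith)
    linarith
  rw [show q * (2 / (1 - exp (-(2 * r)))) = 2 * q / (1 - exp (-(2 * r))) by ring,
    lt_div_iff₀ hpos]
  constructor <;> intro h <;> linarith

/-- Perfect detectors (`q_D = 0`): `η∞ = 0`, the exact-sampling condition reads `η < 0` ("inequality (1)
gives trivial result η < 0"). [cite: QiEtAl2020, p. 2] -/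
theorem etaInfinity_zero_left (r : ℝ) : etaInfinity 0 r = 0 := by simp [etaInfinity]

/-- **The thermal-state approximation**: replacing the quantum part `V_p` by the vacuum `1_2` leaves
`W + 1_2`, which is (t)-classical for every `t < 1` (its `x`-variance is `≥ 1`, its `p`-variance
is exactly the vacuum's). [cite: OhEtAl2024, §III.A ("thermal-state approximation with covariance
matrix W + 1_{2M}")] -/
theorem isTClassical_displacementNoise_add_one {η : ℝ} (hη0 : 0 ≤ η) (hη1 : η ≤ 1) (r : ℝ) {t : ℝ}
    (ht : t < 1) : IsTClassical t (displacementNoise η r + 1) := by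
  have h0 := displacementNoise_apply_zero_nonneg hη0 hη1 r
  have h : displacementNoise η r + (1 : Cov) = diagonal ![displacementNoise η r 0 0 + 1, 1] := by
    ext i j
    fin_cases i <;> fin_cases j <;> simp [displacementNoise]
  rw [h, isTClassical_diagonal_iff]
  exact ⟨by linarith, ht⟩

/-- … but not 1-classical: the `p` quadrature of `W + 1_2` sits exactly at the vacuum level.
[cite: OhEtAl2024, §III.A] [cite: QiEtAl2020, p. 2 (t*_ρ: "the (t)-PQD has δ-function
singularities")] -/
theorem not_isTClassical_one_displacementNoise_add_one (η r : ℝ) :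
    ¬ IsTClassical 1 (displacementNoise η r + 1) := by
  have h : displacementNoise η r + (1 : Cov) = diagonal ![displacementNoise η r 0 0 + 1, 1] := by
    ext i j
    fin_cases i <;> fin_cases j <;> simp [displacementNoise]
  rw [h, isTClassical_diagonal_iff]
  exact fun h => lt_irrefl _ h.2

/-! ### Appendix (gen 21, second part): composing losses, passive optics, the photon ceiling

[QiEtAl2020, p. 3]: "By assuming uniform loss, which is usually a good approximation for integrated
platforms, the interferometer can be simplified to `M` single-mode lossy channels, each with
transmission `η_I`, followed by an ideal unitary transformation `U` (see [12, 13] for a rigorous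
treatment). That is, we can write `A = η_I U`. As a final simplification, we combine the source and
interferometer losses into a single loss channel with transmission `η := η_S η_I`".
[OhEtAl2024, Fig. 2 caption]: "(c) and (d) Actual squeezing parameter and squeezed photon numbers
when the input squeezing parameter is infinite." -/

/-- **Losses compose multiplicatively**: a loss channel of transmission `η₂` followed by one of
transmission `η₁` is the loss channel of transmission `η₁η₂` ("we combine the source and
interferometer losses into a single loss channel with transmission `η := η_S η_I`").
[cite: QiEtAl2020, p. 3] -/
theorem lossCov_lossCov (η₁ η₂ : ℝ) (V : Cov) : lossCov η₁ (lossCov η₂ V) = lossCov (η₁ * η₂) V := by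
  simp only [lossCov, smul_add, smul_smul]
  rw [add_assoc, ← add_smul]
  congr 2
  ring

/-- `η = 1` is the identity channel, `η = 0` replaces the state by the vacuum.
[cite: OhEtAl2024, eq. (4)] -/
theorem lossCov_one (V : Cov) : lossCov 1 V = V := by simp [lossCov]

/-- `η = 0`: total loss leaves the vacuum covariance `1_2`. [cite: OhEtAl2024, eq. (4)] -/
theorem lossCov_zero (V : Cov) : lossCov 0 V = 1 := by simp [lossCov]

/-- **Uniform loss commutes with passive (orthogonal) transformations**: for `O Oᵀ = 1`,
`lossCov η (O V Oᵀ) = O (lossCov η V) Oᵀ` — the step that moves all uniform losses in front of an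
ideal interferometer. [cite: QiEtAl2020, p. 3 ("the interferometer can be simplified to M single-mode
lossy channels … followed by an ideal unitary transformation")] -/
theorem lossCov_conj_of_mul_transpose_eq_one (η : ℝ) {O : Cov} (hO : O * Oᵀ = 1) (V : Cov) :
    lossCov η (O * V * Oᵀ) = O * lossCov η V * Oᵀ := by
  simp only [lossCov, Matrix.mul_add, Matrix.add_mul, Matrix.mul_smul, Matrix.smul_mul,
    Matrix.mul_one, hO]

/-- (t)-classicality is a property of the state up to passive (orthogonal) transformations:
`O V Oᵀ` is (t)-classical iff `V` is, for `O Oᵀ = 1`. [cite: QiEtAl2020, p. 2–3 (definition of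
(t)-classicality; classical Gaussian states are sampled efficiently after any interferometer,
Ref. [11])] -/
theorem isTClassical_conj_iff {t : ℝ} {O : Cov} (hO : O * Oᵀ = 1) (V : Cov) :
    IsTClassical t (O * V * Oᵀ) ↔ IsTClassical t V := by
  have hOT : Oᵀ * O = 1 := mul_eq_one_comm.mp hO
  have key : ∀ {P : Cov}, P * Pᵀ = 1 → ∀ W : Cov, IsTClassical t W → IsTClassical t (P * W * Pᵀ) := by
    intro P hP W hW
    have hinj : Function.Injective P.vecMul :=
      Matrix.vecMul_injective_iff_isUnit.mpr
        ((Matrix.isUnit_iff_isUnit_det P).mpr (Matrix.isUnit_det_of_right_inverse hP))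
    have h := Matrix.PosDef.mul_mul_conjTranspose_same hW hinj
    rw [Matrix.conjTranspose_eq_transpose_of_trivial] at h
    have e : P * W * Pᵀ - t • (1 : Cov) = P * (W - t • 1) * Pᵀ := by
      rw [Matrix.mul_sub, Matrix.sub_mul, Matrix.mul_smul, Matrix.smul_mul, Matrix.mul_one, hP]
    unfold IsTClassical
    rw [e]
    exact h
  constructor
  · intro h
    have h' := key (P := Oᵀ) (by simpa using hOT) _ h
    have e : Oᵀ * (O * V * Oᵀ) * Oᵀᵀ = V := by
      rw [Matrix.transpose_transpose, ← Matrix.mul_assoc, ← Matrix.mul_assoc, hOT, Matrix.one_mul,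
        Matrix.mul_assoc, hOT, Matrix.mul_one]
    rwa [e] at h'
  · exact key hO V

/-- `sinh²(−½ log(1 − η)) = η²/(4(1 − η))`: the closed form of the `r → ∞` photon ceiling plotted in
Fig. 2(d). [cite: OhEtAl2024, p. 4 and Fig. 2(c)(d)] -/
theorem sinh_sq_limit {η : ℝ} (hη1 : η < 1) :
    sinh (-(1 / 2) * log (1 - η)) ^ 2 = η ^ 2 / (4 * (1 - η)) := by
  have hpos : 0 < 1 - η := by linarith
  set x := -(1 / 2) * log (1 - η) with hx
  have hu2 : exp x ^ 2 = (1 - η)⁻¹ := by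
    rw [sq, ← Real.exp_add, show x + x = -log (1 - η) by rw [hx]; ring, Real.exp_neg,
      Real.exp_log hpos]
  have hu : exp x ≠ 0 := (exp_pos x).ne'
  rw [Real.sinh_eq, Real.exp_neg]
  have h4 : ((exp x - (exp x)⁻¹) / 2) ^ 2 = (exp x ^ 2 - 2 + (exp x ^ 2)⁻¹) / 4 := by
    field_simp
    ring
  rw [h4, hu2, inv_inv]
  field_simp
  ring

/-- **The actual squeezed photons are capped by the transmission alone**:
`sinh² s ≤ η²/(4(1 − η))` for every input squeezing `r ≥ 0` (the ceiling of Fig. 2(d)).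
[cite: OhEtAl2024, p. 4 and Fig. 2(d)] -/
theorem sinh_sq_actualSqueezing_le_limit {η : ℝ} (hη0 : 0 ≤ η) (hη1 : η < 1) {r : ℝ}
    (hr : 0 ≤ r) : sinh (actualSqueezing η r) ^ 2 ≤ η ^ 2 / (4 * (1 - η)) := by
  rw [← sinh_sq_limit hη1]
  have hs0 : 0 ≤ sinh (actualSqueezing η r) :=
    Real.sinh_nonneg_iff.mpr (actualSqueezing_nonneg hη0 hη1.le hr)
  have hle : sinh (actualSqueezing η r) ≤ sinh (-(1 / 2) * log (1 - η)) :=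
    Real.sinh_le_sinh.mpr (actualSqueezing_le_limit hη0 hη1 r)
  exact pow_le_pow_left₀ hs0 hle 2

/-- **The lossy squeezed state is (t)-classical iff its quantum part `V_p` is**: both mean
`t < e^{−2s} = a₋` (SM (21) with `n = 0` applied to `V_p`; the classical part `W` only adds
variance). [cite: OhEtAl2024, App. B (B3)] [cite: QiEtAl2020, SM §III eq. (21)] -/
theorem isTClassical_lossCov_sqzCov_iff_quantumPart {η : ℝ} (hη0 : 0 ≤ η) (hη1 : η ≤ 1) {r : ℝ}
    (hr : 0 ≤ r) (t : ℝ) :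
    IsTClassical t (lossCov η (sqzCov r)) ↔ IsTClassical t (sqzCov (actualSqueezing η r)) := by
  rw [isTClassical_lossCov_sqzCov_iff hη0 hr, sqzCov, isTClassical_diagonal_iff,
    exp_neg_two_mul_actualSqueezing hη0 hη1, exp_two_mul_actualSqueezing hη0 hη1]
  constructor
  · intro h
    refine ⟨lt_of_lt_of_le h ?_, h⟩
    exact (aMinus_le_one hη0 hr).trans ((one_le_inv₀ (aMinus_pos hη0 hη1 r)).mpr
      (aMinus_le_one hη0 hr))
  · exact fun h => h.2

/-! ### Appendix (gen 21, third part): the (t)-ordered quasiprobability of a diagonal single-mode state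

[QiEtAl2020] eq. (3), p. 2: "`W^{(t)}_ρ(x) = exp[−½ xᵀ(V_ρ − tI_2)⁻¹x] / (2π √det(V_ρ − tI_2))` … Equation (56) [sic: (3)]
only holds when `V_ρ − tI_2` is positive definite … for `t < t*_ρ` the (t)-PQD is a Gaussian function". For the diagonal
matrices of this file, `V = diag(a, b)`, the quadratic form is `x²/(a − t) + p²/(b − t)` and the determinant is
`(a − t)(b − t)`; the three lemmas below record exactly that, and `tPQD` is eq. (3) in these coordinates. -/

/-- `diag(a, b) − t·1 = diag(a − t, b − t)`. [cite: QiEtAl2020, eq. (3) (the matrix V_ρ − tI_2)] -/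
theorem diagonal_sub_smul_one (t a b : ℝ) :
    diagonal ![a, b] - t • (1 : Cov) = diagonal ![a - t, b - t] := by
  ext i j
  fin_cases i <;> fin_cases j <;> simp [sub_eq_add_neg]

/-- `det(diag(a, b) − tI_2) = (a − t)(b − t)`. [cite: QiEtAl2020, eq. (3) (the normalisation √det(V_ρ − tI_2))] -/
theorem det_diagonal_sub_smul_one (t a b : ℝ) :
    (diagonal ![a, b] - t • (1 : Cov)).det = (a - t) * (b - t) := by
  rw [diagonal_sub_smul_one, det_diagonal, Fin.prod_univ_two]
  simp

/-- `(diag(a, b) − tI_2)⁻¹ = diag((a − t)⁻¹, (b − t)⁻¹)` when `a ≠ t`, `b ≠ t` (in particular in the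
(t)-classical case), so `xᵀ(V − tI_2)⁻¹x = x²/(a − t) + p²/(b − t)`. [cite: QiEtAl2020, eq. (3) (the exponent)] -/
theorem inv_diagonal_sub_smul_one {t a b : ℝ} (ha : a ≠ t) (hb : b ≠ t) :
    (diagonal ![a, b] - t • (1 : Cov))⁻¹ = diagonal ![(a - t)⁻¹, (b - t)⁻¹] := by
  rw [diagonal_sub_smul_one]
  apply Matrix.inv_eq_right_inv
  rw [diagonal_mul_diagonal, ← diagonal_one]
  congr 1
  funext i
  fin_cases i
  · simp [mul_inv_cancel₀ (sub_ne_zero.mpr ha)]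
  · simp [mul_inv_cancel₀ (sub_ne_zero.mpr hb)]

/-- **The (t)-PQD of eq. (3) for `V = diag(a, b)`**, as a function on phase space `ℝ × ℝ` (`z = (x, p)`):
`W^{(t)}(x, p) = exp(−(x²/(a − t) + p²/(b − t))/2) / (2π √((a − t)(b − t)))`. [cite: QiEtAl2020, eq. (3)] -/
def tPQD (t a b : ℝ) (z : ℝ × ℝ) : ℝ :=
  Real.exp (-(z.1 ^ 2 / (a - t) + z.2 ^ 2 / (b - t)) / 2) / (2 * π * Real.sqrt ((a - t) * (b - t)))

/-- In the (t)-classical case `t < a`, `t < b` (cf. `isTClassical_diagonal_iff`) the (t)-PQD is the product of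
two centred normal densities of variances `a − t` and `b − t` — "for t < t*_ρ the (t)-PQD is a Gaussian
function". [cite: QiEtAl2020, eq. (3) and p. 2] -/
theorem tPQD_eq_mul_gaussianPDFReal {t a b : ℝ} (ha : t < a) (hb : t < b) (z : ℝ × ℝ) :
    tPQD t a b z =
      ProbabilityTheory.gaussianPDFReal 0 (a - t).toNNReal z.1 *
        ProbabilityTheory.gaussianPDFReal 0 (b - t).toNNReal z.2 := by
  have hA : 0 < a - t := sub_pos.mpr ha
  have hB : 0 < b - t := sub_pos.mpr hb
  simp only [ProbabilityTheory.gaussianPDFReal, Real.coe_toNNReal _ hA.le, Real.coe_toNNReal _ hB.le,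
    sub_zero, tPQD]
  have hsqrt : Real.sqrt (2 * π * (a - t)) * Real.sqrt (2 * π * (b - t)) =
      2 * π * Real.sqrt ((a - t) * (b - t)) := by
    rw [← Real.sqrt_mul (by positivity), show 2 * π * (a - t) * (2 * π * (b - t)) =
      (2 * π) ^ 2 * ((a - t) * (b - t)) by ring, Real.sqrt_mul (by positivity), Real.sqrt_sq (by positivity)]
  have hexp : Real.exp (-(z.1 ^ 2 / (a - t) + z.2 ^ 2 / (b - t)) / 2) =
      Real.exp (-z.1 ^ 2 / (2 * (a - t))) * Real.exp (-z.2 ^ 2 / (2 * (b - t))) := by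
    rw [← Real.exp_add]
    congr 1
    field_simp
    ring
  rw [hexp, ← hsqrt]
  have h1 : Real.sqrt (2 * π * (a - t)) ≠ 0 := (Real.sqrt_pos.mpr (by positivity)).ne'
  have h2 : Real.sqrt (2 * π * (b - t)) ≠ 0 := (Real.sqrt_pos.mpr (by positivity)).ne'
  field_simp

/-- The (t)-PQD is strictly positive in the (t)-classical case. [cite: QiEtAl2020, eq. (3) and p. 2] -/
theorem tPQD_pos {t a b : ℝ} (ha : t < a) (hb : t < b) (z : ℝ × ℝ) : 0 < tPQD t a b z := by
  have hA : 0 < a - t := sub_pos.mpr ha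
  have hB : 0 < b - t := sub_pos.mpr hb
  unfold tPQD
  exact div_pos (Real.exp_pos _) (by positivity)

/-- **The (t)-PQD is a normalised probability density in the (t)-classical case**: `∫∫ W^{(t)} dx dp = 1`
(the statement behind "classical Gaussian states can be sampled efficiently": for `t < a`, `t < b` one samples
two independent centred normals). [cite: QiEtAl2020, eq. (3) and p. 2 ("for t < t*_ρ the (t)-PQD is a
Gaussian function")] -/
theorem integral_tPQD_eq_one {t a b : ℝ} (ha : t < a) (hb : t < b) :
    ∫ z : ℝ × ℝ, tPQD t a b z = 1 := by
  have hA : (a - t).toNNReal ≠ 0 := by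
    intro h; have := Real.toNNReal_eq_zero.mp h; linarith
  have hB : (b - t).toNNReal ≠ 0 := by
    intro h; have := Real.toNNReal_eq_zero.mp h; linarith
  have hfun : tPQD t a b = fun z : ℝ × ℝ =>
      ProbabilityTheory.gaussianPDFReal 0 (a - t).toNNReal z.1 *
        ProbabilityTheory.gaussianPDFReal 0 (b - t).toNNReal z.2 :=
    funext (tPQD_eq_mul_gaussianPDFReal ha hb)
  rw [hfun, MeasureTheory.Measure.volume_eq_prod, MeasureTheory.integral_prod_mul,
    ProbabilityTheory.integral_gaussianPDFReal_eq_one 0 hA,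
    ProbabilityTheory.integral_gaussianPDFReal_eq_one 0 hB, mul_one]

/-- Packaging with `isTClassical_diagonal_iff`: a (t)-classical diagonal single-mode state has a positive,
normalised (t)-PQD. [cite: QiEtAl2020, p. 2–3 ((t)-classical ⇔ V_ρ − tI_2 positive definite ⇔ the (t)-PQD is
a Gaussian function)] -/
theorem tPQD_of_isTClassical {t a b : ℝ} (h : IsTClassical t (diagonal ![a, b])) :
    (∀ z, 0 < tPQD t a b z) ∧ ∫ z : ℝ × ℝ, tPQD t a b z = 1 := by
  rw [isTClassical_diagonal_iff] at h
  exact ⟨tPQD_pos h.1 h.2, integral_tPQD_eq_one h.1 h.2⟩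


/-! ### Appendix (gen 21, fourth part): the squeezing phase ([QiEtAl2020] SM eq. (20)–(21))

[QiEtAl2020] SM §III, p. 8–9: "Any zero-mean single-mode Gaussian state can be decomposed into a squeezed thermal
state `ρ = S(s_ρ, φ_ρ) ρ^T_{n_ρ} S†(s_ρ, φ_ρ)` … The covariance matrix of ρ can be written as
`V_ρ = V_STS(s_ρ, n_ρ, φ_ρ) = (2n_ρ + 1) ( cosh 2s_ρ − cos φ_ρ sinh 2s_ρ , − sin φ_ρ sinh 2s_ρ ; − sin φ_ρ sinh 2s_ρ ,
cosh s_ρ [sic: cosh 2s_ρ] + cos φ_ρ sinh 2s_ρ )` (20). Recall that a single-mode Gaussian state is (t)-classical when `V_ρ − tI_2`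
is positive definite. From Eq. (20) we know that this happens when `s_ρ ≤ ½ ln((2n_ρ + 1)/t)` (21)."
We realise the phase as a phase-space rotation `rot θ` applied to the diagonal `stsCov s n` of this file; the
entries come out as `(2n + 1)(cosh 2s + cos 2θ sinh 2s)`, `(2n + 1) sin 2θ sinh 2s`, `(2n + 1)(cosh 2s − cos 2θ sinh 2s)`,
which is (20) with `2θ = φ + π`. Since `rot θ` is orthogonal, `isTClassical_conj_iff` shows that the phase does not
affect (t)-classicality, so criterion (21) (strict form, `isTClassical_stsCov_iff_lt_log`) holds for every phase. -/

/-- Phase-space rotation by `θ`. [cite: QiEtAl2020, SM §III eq. (18)–(20) (the phase φ of the Stoler squeezer,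
realised on the covariance matrix as a rotation)] -/
def rot (θ : ℝ) : Cov := !![Real.cos θ, -Real.sin θ; Real.sin θ, Real.cos θ]

/-- `rot θ` is orthogonal. [cite: QiEtAl2020, SM §III (symplectic orthogonal phase rotation)] -/
theorem rot_mul_transpose (θ : ℝ) : rot θ * (rot θ)ᵀ = 1 := by
  ext i j
  fin_cases i <;> fin_cases j <;>
    simp [rot, Matrix.mul_apply, Fin.sum_univ_two, Matrix.transpose_apply] <;>
    nlinarith [Real.sin_sq_add_cos_sq θ]

/-- The squeezed thermal covariance with a squeezing phase: `rot θ · V_STS(s, n) · (rot θ)ᵀ`.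
[cite: QiEtAl2020, SM §III eq. (20)] -/
def stsCovRot (s n θ : ℝ) : Cov := rot θ * stsCov s n * (rot θ)ᵀ

/-- `V_STS(s, n)` as an explicit 2×2 matrix. [cite: OhEtAl2024, App. B (B6)] -/
theorem stsCov_eq_of (s n : ℝ) :
    stsCov s n = !![(2 * n + 1) * exp (2 * s), 0; 0, (2 * n + 1) * exp (-(2 * s))] := by
  ext i j
  fin_cases i <;> fin_cases j <;> simp [stsCov]

/-- Zero phase gives back the diagonal form. [cite: QiEtAl2020, SM §III eq. (20) with φ = π (cos φ = −1, sin φ = 0)] -/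
@[simp] theorem stsCovRot_zero (s n : ℝ) : stsCovRot s n 0 = stsCov s n := by
  have h : rot 0 = 1 := by
    ext i j; fin_cases i <;> fin_cases j <;> simp [rot]
  simp [stsCovRot, h]

/-- Entry (1,1) of eq. (20): `(2n + 1)(e^{2s} cos²θ + e^{−2s} sin²θ)`. [cite: QiEtAl2020, SM §III eq. (20)] -/
theorem stsCovRot_apply_00 (s n θ : ℝ) :
    stsCovRot s n θ 0 0 = (2 * n + 1) * (exp (2 * s) * Real.cos θ ^ 2 + exp (-(2 * s)) * Real.sin θ ^ 2) := by
  rw [stsCovRot, stsCov_eq_of]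
  simp [rot, Matrix.mul_apply, Fin.sum_univ_two]
  ring

/-- Entry (1,2) = (2,1) of eq. (20): `(2n + 1)(e^{2s} − e^{−2s}) cos θ sin θ`. [cite: QiEtAl2020, SM §III eq. (20)] -/
theorem stsCovRot_apply_01 (s n θ : ℝ) :
    stsCovRot s n θ 0 1 = (2 * n + 1) * ((exp (2 * s) - exp (-(2 * s))) * (Real.cos θ * Real.sin θ)) := by
  rw [stsCovRot, stsCov_eq_of]
  simp [rot, Matrix.mul_apply, Fin.sum_univ_two]
  ring

/-- Entry (2,1). [cite: QiEtAl2020, SM §III eq. (20)] -/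
theorem stsCovRot_apply_10 (s n θ : ℝ) :
    stsCovRot s n θ 1 0 = (2 * n + 1) * ((exp (2 * s) - exp (-(2 * s))) * (Real.cos θ * Real.sin θ)) := by
  rw [stsCovRot, stsCov_eq_of]
  simp [rot, Matrix.mul_apply, Fin.sum_univ_two]
  ring

/-- Entry (2,2) of eq. (20): `(2n + 1)(e^{2s} sin²θ + e^{−2s} cos²θ)`. [cite: QiEtAl2020, SM §III eq. (20)] -/
theorem stsCovRot_apply_11 (s n θ : ℝ) :
    stsCovRot s n θ 1 1 = (2 * n + 1) * (exp (2 * s) * Real.sin θ ^ 2 + exp (-(2 * s)) * Real.cos θ ^ 2) := by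
  rw [stsCovRot, stsCov_eq_of]
  simp [rot, Matrix.mul_apply, Fin.sum_univ_two]
  ring

/-- The printed hyperbolic form of eq. (20): with `c = cos 2θ`, `σ = sin 2θ` the entries are
`(2n + 1)(cosh 2s + c sinh 2s)`, `(2n + 1) σ sinh 2s`, `(2n + 1)(cosh 2s − c sinh 2s)`; Qi et al.'s phase `φ`
corresponds to `2θ = φ + π` (`cos 2θ = −cos φ`, `sin 2θ = −sin φ`). [cite: QiEtAl2020, SM §III eq. (20)] -/
theorem stsCovRot_eq_hyperbolic (s n θ : ℝ) :
    stsCovRot s n θ 0 0 = (2 * n + 1) * (Real.cosh (2 * s) + Real.cos (2 * θ) * Real.sinh (2 * s)) ∧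
    stsCovRot s n θ 0 1 = (2 * n + 1) * (Real.sin (2 * θ) * Real.sinh (2 * s)) ∧
    stsCovRot s n θ 1 1 = (2 * n + 1) * (Real.cosh (2 * s) - Real.cos (2 * θ) * Real.sinh (2 * s)) := by
  have hc := Real.sin_sq_add_cos_sq θ
  refine ⟨?_, ?_, ?_⟩
  · rw [stsCovRot_apply_00, Real.cosh_eq, Real.sinh_eq, Real.cos_sq θ]
    have : Real.sin θ ^ 2 = 1 - Real.cos θ ^ 2 := by linarith
    rw [this, Real.cos_sq θ]; ring
  · rw [stsCovRot_apply_01, Real.sinh_eq, Real.sin_two_mul]; ring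
  · rw [stsCovRot_apply_11, Real.cosh_eq, Real.sinh_eq, Real.cos_sq θ]
    have : Real.sin θ ^ 2 = 1 - Real.cos θ ^ 2 := by linarith
    rw [this, Real.cos_sq θ]; ring

/-- **The squeezing phase does not affect (t)-classicality**: `rot θ · V_STS · (rot θ)ᵀ` is (t)-classical iff
`V_STS` is. [cite: QiEtAl2020, SM §III eq. (20)–(21) ("From Eq. (20) we know that this happens when
s_ρ ≤ ½ ln((2n_ρ + 1)/t)" — a condition independent of φ_ρ)] -/
theorem isTClassical_stsCovRot_iff (s n θ t : ℝ) :
    IsTClassical t (stsCovRot s n θ) ↔ IsTClassical t (stsCov s n) :=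
  isTClassical_conj_iff (rot_mul_transpose θ) (stsCov s n)

/-- **Criterion (21) for an arbitrary zero-mean single-mode Gaussian state** (strict form): for `s ≥ 0`,
`n ≥ 0`, `t > 0` and any phase, `V_STS(s, n, φ)` is (t)-classical iff `s < ½ ln((2n + 1)/t)`.
[cite: QiEtAl2020, SM §III eq. (21)] -/
theorem isTClassical_stsCovRot_iff_lt_log {s n t : ℝ} (hs : 0 ≤ s) (hn : 0 ≤ n) (ht : 0 < t) (θ : ℝ) :
    IsTClassical t (stsCovRot s n θ) ↔ s < 1 / 2 * log ((2 * n + 1) / t) := by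
  rw [isTClassical_stsCovRot_iff, isTClassical_stsCov_iff_lt_log hs hn ht]


end LossySqueezedState

end Literature.Computability.QuantumComplexity

end
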